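import Literature.NumberTheory.BeurlingPrimes.DeletedPrimes
import Literature.NumberTheory.BeurlingPrimes.HilberdinkMellin
import Literature.NumberTheory.BeurlingPrimes.IntegerContinuation
import Mathlib.Analysis.Analytic.Uniqueness
import Mathlib.Analysis.Complex.CauchyIntegral
import Mathlib.NumberTheory.LSeries.RiemannZeta
import HarnessLib

/-!
# The `𝒫_𝒮`-free integers: Mellin continuation, the Abel constant `I(β)`, and the boundary case

Topic `Literature/NumberTheory/BeurlingPrimes`. Everything in this file is PROVED (definitions + theorems).

This is the analytic half of the "integers" part of Broucke–Debruyne–Révész (arXiv:2309.01567), proof of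
Theorem 1.3, second assertion (§5 pp. 16–17), written for an ARBITRARY set `S` of rational primes with
infinitely many primes outside `S`, and an ABSTRACT holomorphic continuation `Z` of `(s − 1) ζ_𝒩(s)`, where
`ζ_𝒩(s) = ∑_{n S-free} n^{−s} = ζ(s)/ζ_𝒮(s)` is the zeta function of the Beurling system `ℙ ∖ 𝒫_𝒮`
(`keptSystem S`; in §5, `Z(s) = (s−1)ζ(s)/ζ_𝒮(s)` continued to `Re s > α/2` under RH). No named fact is
introduced; the continuation enters as a hypothesis.

* `keptSystem S hT = ratPrimes.restrict (keptIdx S)`: its integer-counting function is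
  `N'(x) = #{n ≤ x : n S-free} = ∑_{n ≤ x} freeInd S n` (`intCount_keptSystem`, `intCount_keptSystem_eq_partialSum`).
* `BeurlingPrimes.zeta_eq_mul_of_equiv`, `BeurlingPrimes.zeta_powers`, `zeta_ratPrimes` — the zeta function
  of a rearranged union `P ∪ Q` is `ζ_P ζ_Q`, that of `P^{r}` is `ζ_P(rs)`, that of `ℙ` is `ζ` (`Re s > 1`); so
  for BDR's `𝒫_{α,β} = ℙ ∪ ℙ^{1/β} ∖ 𝒫_𝒮` (tree `delSystem`), `ζ_{α,β}(s) = ζ_𝒩(s) ζ(s/β)`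
  ("`ζ_{α,β}(s) = ζ(s)ζ(s/β)/ζ_𝒮(s)`", p. 17) (`zeta_delSystem`).
* `abelConst_freeInd_eq` — **(I)**: if `|N'(t) − at| ≤ C t^γ` (`t ≥ 1`, `0 ≤ γ < 1`) and `Z` is holomorphic on
  `Re s > γ` with `Z(s) = (s−1)ζ_𝒩(s)` for `Re s > 1`, then `a = Z(1)` and, for every real `β ∈ (γ, 1)`,
  Lemma 5.1's constant `I(β) = lim_R (∑_{n ≤ R, n ∈ 𝒩} n^{−β} − aR^{1−β}/(1−β))` (tree `abelConst`) satisfies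
  `(β − 1) I(β) = Z(β)` — "that is the value at `β` of the meromorphic extension of `∑_{n ∈ 𝒩} n^{−s}`"
  (Lemma 5.1) — by the uniqueness of analytic continuation applied to Hilberdink's Mellin continuation
  `Z̃(s) = as + s(s−1)∫₁^∞ (N'(x) − ax)x^{−s−1} dx` (tree `Hilberdink.Ztilde`). In particular `I(β) ≠ 0` iff
  `Z(β) ≠ 0` and `a ≠ 0` iff `Z(1) ≠ 0` ("`ζ_𝒮(s)` cannot vanish at `s = 1` or `s = β`", p. 17).
* `not_intErrorLE_boundary` — **(∂)**, the boundary case `β = 2α/(α+2)`: if `Z(β) ≠ 0` then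
  `#{(n, m) : n S-free, m ≥ 1, n m^{1/β} ≤ x}` is NOT `Ax + O(x^{β−ε})` for any `A`, `ε > 0` — "The
  integers of the system `𝒩_{α,β}` can also not be better than `β`-well-behaved as that would entail that the
  zeta function `ζ_{α,β}(s) = ζ(s)ζ(s/β)/ζ_𝒮(s)` is analytic at `s = β`, which is false" (p. 17): such a
  bound continues `(s−1)ζ_{α,β}(s)` holomorphically to `Re s > β − ε`, while `Z(s)ζ(s/β)` blows up at `s = β`.

## References
* [BrouckeDebruyneRevesz2023] F. Broucke, G. Debruyne, Sz. Gy. Révész, *Some examples of well-behaved Beurling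
  number systems*, arXiv:2309.01567 (Trans. AMS 2024), Lemma 5.1 and §5 pp. 16–17 (read).
* [Hilberdink2005] T. W. Hilberdink, *Well-behaved Beurling primes and integers*, J. Number Theory 112 (2005)
  332–344, §1 (1.1) (the Mellin continuation, tree `HilberdinkMellin.lean`).
-/

noncomputable section

open Complex Filter Set MeasureTheory
open scoped Topology

namespace Literature.NumberTheory.BeurlingPrimes

open Literature.Barriers.RiemannHypothesis

/-! ### Zeta functions of rearranged unions, of powers, and of the rational primes -/

section zeta

variable {P Q R : BeurlingPrimes} {e : ℕ ≃ ℕ ⊕ ℕ}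

/-- `((a b : ℝ) : ℂ)^{−s} = (a : ℂ)^{−s} (b : ℂ)^{−s}` for `a, b ≥ 0`. [folklore] -/
theorem ofReal_mul_cpow_neg {a b : ℝ} (ha : 0 ≤ a) (hb : 0 ≤ b) (s : ℂ) :
    (((a * b : ℝ)) : ℂ) ^ (-s) = ((a : ℂ)) ^ (-s) * ((b : ℂ)) ^ (-s) := by
  push_cast
  exact Complex.mul_cpow_ofReal_nonneg ha hb (-s)

/-- **The zeta function of a union is the product**: if the primes of `R` are a rearrangement of those of
`P` and `Q` (`R.prime n = Sum.elim P.prime Q.prime (e n)`), then `ζ_R(s) = ζ_P(s) ζ_Q(s)` whenever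
`Re s > 0` and `∑_j λ_j^{−σ}` converges for both `P` and `Q`. [folklore] -/
theorem _root_.Literature.Barriers.RiemannHypothesis.BeurlingPrimes.zeta_eq_mul_of_equiv
    (he : ∀ n, R.prime n = Sum.elim P.prime Q.prime (e n)) {s : ℂ} (hs : 0 < s.re)
    (hP : Summable fun j ↦ P.prime j ^ (-s.re)) (hQ : Summable fun j ↦ Q.prime j ^ (-s.re)) :
    R.zeta s = P.zeta s * Q.zeta s := by
  have hPn := P.summable_norm_genInt_cpow hs hP
  have hQn := Q.summable_norm_genInt_cpow hs hQ
  unfold BeurlingPrimes.zeta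
  rw [tsum_mul_tsum_of_summable_norm hPn hQn, ← (pairExpEquiv e).tsum_eq]
  refine tsum_congr fun kk ↦ ?_
  rw [pairExpEquiv_apply, BeurlingPrimes.genInt_pairToExp he,
    ofReal_mul_cpow_neg (P.genInt_pos kk.1).le (Q.genInt_pos kk.2).le]

/-- **The zeta function of the `r`-th powers**: `ζ_{P^r}(s) = ζ_P(rs)` (`r > 0`). [folklore] -/
theorem _root_.Literature.Barriers.RiemannHypothesis.BeurlingPrimes.zeta_powers (P : BeurlingPrimes) {r : ℝ}
    (hr : 0 < r) (s : ℂ) : (P.powers r hr).zeta s = P.zeta (r * s) := by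
  unfold BeurlingPrimes.zeta
  refine tsum_congr fun k ↦ ?_
  rw [BeurlingPrimes.genInt_powers]
  have hg := P.genInt_pos k
  rw [Complex.ofReal_cpow hg.le, ← Complex.cpow_mul]
  · congr 1; ring
  · rw [← Complex.ofReal_log hg.le, ← Complex.ofReal_mul, Complex.ofReal_im]
    exact neg_lt_zero.mpr Real.pi_pos
  · rw [← Complex.ofReal_log hg.le, ← Complex.ofReal_mul, Complex.ofReal_im]
    exact Real.pi_pos.le

/-- **`ζ_ℙ(s) = ζ(s)`** for `Re s > 1`: the generalized integers of the rational primes are the positive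
integers (`genInt_ratPrimes`). [folklore] -/
theorem zeta_ratPrimes {s : ℂ} (hs : 1 < s.re) : ratPrimes.zeta s = riemannZeta s := by
  unfold BeurlingPrimes.zeta
  rw [zeta_eq_tsum_one_div_nat_cpow hs]
  have hs0 : -s ≠ 0 := by
    intro h; rw [neg_eq_zero] at h; rw [h] at hs; simp at hs; linarith
  -- reindex by `encode : (ℕ →₀ ℕ) ≃ ℕ₊`
  have h1 : ∑' k : ℕ →₀ ℕ, ((ratPrimes.genInt k : ℝ) : ℂ) ^ (-s) =
      ∑' n : {n : ℕ // n ≠ 0}, ((n : ℕ) : ℂ) ^ (-s) := by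
    rw [← encodeEquiv.tsum_eq]
    refine tsum_congr fun k ↦ ?_
    rw [genInt_ratPrimes]
    push_cast
    rfl
  have h2 : ∑' n : {n : ℕ // n ≠ 0}, ((n : ℕ) : ℂ) ^ (-s) =
      ∑' n : ℕ, {n : ℕ | n ≠ 0}.indicator (fun n : ℕ ↦ (n : ℂ) ^ (-s)) n :=
    tsum_subtype {n : ℕ | n ≠ 0} (fun n : ℕ ↦ (n : ℂ) ^ (-s))
  rw [h1, h2]
  refine tsum_congr fun n ↦ ?_
  rw [one_div, ← cpow_neg]
  by_cases hn : n = 0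
  · subst hn
    rw [indicator_of_notMem (by simp), Nat.cast_zero, zero_cpow hs0]
  · rw [indicator_of_mem (by simpa using hn)]

/-- `N_ℙ(x) ≤ x` on `[1, ∞)` (indeed `= ⌊x⌋`). [folklore] -/
theorem intCount_ratPrimes_le {x : ℝ} (hx : 1 ≤ x) : (ratPrimes.intCount x : ℝ) ≤ 1 * x := by
  rw [intCount_ratPrimes (by linarith), one_mul]
  exact Nat.floor_le (by linarith)

/-- `∑_p p^{−σ} < ∞` for `σ > 1` (the rational primes as a Beurling system). [folklore] -/
theorem summable_ratPrimes_prime_rpow {σ : ℝ} (hσ : 1 < σ) : Summable fun j ↦ ratPrimes.prime j ^ (-σ) :=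
  Hilberdink.summable_prime_rpow ratPrimes (fun _ hx ↦ intCount_ratPrimes_le hx) hσ

/-- `∑_p (p^r)^{−σ} < ∞` for `rσ > 1` (the powers `ℙ^r`). [folklore] -/
theorem summable_powers_prime_rpow {r : ℝ} (hr : 0 < r) {σ : ℝ} (hσ : 1 < r * σ) :
    Summable fun j ↦ (ratPrimes.powers r hr).prime j ^ (-σ) := by
  refine (summable_ratPrimes_prime_rpow hσ).congr fun j ↦ ?_
  show ratPrimes.prime j ^ (-(r * σ)) = (ratPrimes.prime j ^ r) ^ (-σ)
  rw [← Real.rpow_mul (ratPrimes.prime_pos j).le]; ring_nf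

end zeta

/-! ### The system `ℙ ∖ 𝒫_𝒮` of kept primes and its integers, the `S`-free numbers -/

section kept

variable (S : Set ℕ)

/-- **`ℙ ∖ 𝒫_𝒮`**: the rational primes not in `S`, as a Beurling system (there must be infinitely many).
Its integers are the `S`-free positive integers `𝒩`. [cite: BrouckeDebruyneRevesz2023, §5 p. 16] -/
def keptSystem (hT : (keptIdx S).Infinite) : BeurlingPrimes := ratPrimes.restrict hT

variable {S}

/-- **`N'(x) = #{n ≤ x : n ≥ 1 S-free}`** is the integer-counting function of `ℙ ∖ 𝒫_𝒮`.
[cite: BrouckeDebruyneRevesz2023, §5 p. 16] -/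
theorem intCount_keptSystem (hT : (keptIdx S).Infinite) (x : ℝ) :
    (keptSystem S hT).intCount x = Nat.card {n : ℕ // (n ≠ 0 ∧ IsFree S n) ∧ (n : ℝ) ≤ x} := by
  unfold keptSystem
  rw [BeurlingPrimes.intCount_restrict]
  have e1 : {k : ℕ →₀ ℕ // (k.support : Set ℕ) ⊆ keptIdx S ∧ ratPrimes.genInt k ≤ x} ≃
      {q : {k : ℕ →₀ ℕ // (k.support : Set ℕ) ⊆ keptIdx S} // ratPrimes.genInt q.1 ≤ x} :=
    (Equiv.subtypeSubtypeEquivSubtypeInter (fun k : ℕ →₀ ℕ ↦ (k.support : Set ℕ) ⊆ keptIdx S)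
      (fun k ↦ ratPrimes.genInt k ≤ x)).symm
  have e2 : {q : {k : ℕ →₀ ℕ // (k.support : Set ℕ) ⊆ keptIdx S} // ratPrimes.genInt q.1 ≤ x} ≃
      {q : {n : ℕ // n ≠ 0 ∧ IsFree S n} // ((q.1 : ℕ) : ℝ) ≤ x} :=
    Equiv.subtypeEquiv (freeEquiv S) fun q ↦ by
      rw [genInt_ratPrimes]; exact Iff.rfl
  exact Nat.card_congr ((e1.trans e2).trans (Equiv.subtypeSubtypeEquivSubtypeInter
    (fun n : ℕ ↦ n ≠ 0 ∧ IsFree S n) (fun n ↦ (n : ℝ) ≤ x)))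

/-- `N'(x) = ∑_{n ≤ x} freeInd S n` for `x ≥ 0`. [cite: BrouckeDebruyneRevesz2023, §5 p. 16] -/
theorem intCount_keptSystem_eq_partialSum (hT : (keptIdx S).Infinite) {x : ℝ} (hx : 0 ≤ x) :
    ((keptSystem S hT).intCount x : ℝ) = partialSum (freeInd S) x := by
  rw [intCount_keptSystem, partialSum_freeInd_eq_card S hx]

/-- `N'(x) ≤ x` on `[1, ∞)`. [folklore] -/
theorem intCount_keptSystem_le (hT : (keptIdx S).Infinite) {x : ℝ} (hx : 1 ≤ x) :
    ((keptSystem S hT).intCount x : ℝ) ≤ 1 * x := by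
  rw [intCount_keptSystem_eq_partialSum hT (by linarith), one_mul]
  unfold partialSum
  calc ∑ k ∈ Finset.Icc 0 ⌊x⌋₊, freeInd S k ≤ ∑ k ∈ Finset.Icc 0 ⌊x⌋₊, posInd k := by
        refine Finset.sum_le_sum fun k _ ↦ ?_
        rcases eq_or_ne k 0 with rfl | hk
        · simp
        · rw [posInd_of_ne_zero hk]; exact freeInd_le_one S k
    _ = ⌊x⌋₊ := partialSum_posInd x
    _ ≤ x := Nat.floor_le (by linarith)

/-- `∑_{p ∉ S} p^{−σ} < ∞` for `σ > 1`. [folklore] -/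
theorem summable_keptSystem_prime_rpow (hT : (keptIdx S).Infinite) {σ : ℝ} (hσ : 1 < σ) :
    Summable fun j ↦ (keptSystem S hT).prime j ^ (-σ) :=
  Hilberdink.summable_prime_rpow _ (fun _ hx ↦ intCount_keptSystem_le hT hx) hσ

/-- **`ζ_{α,β}(s) = ζ_𝒩(s) ζ(s/β)`** for `Re s > 1` (`𝒫_{α,β} = (ℙ ∖ 𝒫_𝒮) ∪ ℙ^{1/β}`, `r = 1/β > 1`): BDR's
"`ζ_{α,β}(s) = ζ(s)ζ(s/β)/ζ_𝒮(s)`". [cite: BrouckeDebruyneRevesz2023, §5 p. 17] -/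
theorem zeta_delSystem (hT : (keptIdx S).Infinite) {r : ℝ} (hr : 1 < r) {s : ℂ} (hs : 1 < s.re) :
    (delSystem S hT r (by linarith)).zeta s = (keptSystem S hT).zeta s * riemannZeta (r * s) := by
  have hr0 : 0 < r := by linarith
  have hs0 : 0 < s.re := by linarith
  have hrs : 1 < r * s.re := by nlinarith
  have hrs' : 1 < ((r : ℂ) * s).re := by rwa [Complex.re_ofReal_mul]
  show ((keptSystem S hT).merge (ratPrimes.powers r hr0)).zeta s = _
  rw [BeurlingPrimes.zeta_eq_mul_of_equiv (e := mergeEquiv _ _)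
      (fun n ↦ BeurlingPrimes.prime_merge _ _ n) hs0 (summable_keptSystem_prime_rpow hT hs)
      (summable_powers_prime_rpow hr0 hrs),
    BeurlingPrimes.zeta_powers, zeta_ratPrimes hrs']

end kept

/-! ### Uniqueness of analytic continuation on (punctured) half-planes -/

/-- The punctured half-plane `{Re s > σ} ∖ {p}` (`p` real) is preconnected (translate of the tree's
`isPreconnected_puncturedHalfPlane`). [folklore] -/
theorem isPreconnected_halfPlane_diff_ofReal (σ p : ℝ) :
    IsPreconnected {s : ℂ | σ < s.re ∧ s ≠ (p : ℂ)} := by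
  have h := (isPreconnected_puncturedHalfPlane (σ - p + 1)).image (fun z : ℂ ↦ z + ((p - 1 : ℝ) : ℂ))
    (Continuous.continuousOn (by fun_prop))
  convert h using 1
  ext s
  simp only [mem_setOf_eq, mem_image]
  constructor
  · rintro ⟨hs, hsp⟩
    refine ⟨s - ((p - 1 : ℝ) : ℂ), ⟨?_, ?_⟩, by ring⟩
    · simp; linarith
    · intro h1
      apply hsp
      have : s = 1 + ((p - 1 : ℝ) : ℂ) := by rw [← h1]; ring
      rw [this]; push_cast; ring
  · rintro ⟨z, ⟨hz, hz1⟩, rfl⟩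
    refine ⟨by simp; linarith, fun h1 ↦ hz1 ?_⟩
    have : z = (p : ℂ) - ((p - 1 : ℝ) : ℂ) := by rw [← h1]; ring
    rw [this]; push_cast; ring

/-- **Uniqueness on a half-plane**: two functions holomorphic on `{Re s > σ}` (`σ ≤ 1`) that agree on
`{Re s > 1}` agree on `{Re s > σ}`. [folklore] -/
theorem eqOn_halfPlane_of_eqOn {f g : ℂ → ℂ} {σ : ℝ} (hσ : σ ≤ 1)
    (hf : DifferentiableOn ℂ f {s : ℂ | σ < s.re}) (hg : DifferentiableOn ℂ g {s : ℂ | σ < s.re})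
    (h : ∀ s : ℂ, 1 < s.re → f s = g s) : EqOn f g {s : ℂ | σ < s.re} := by
  have ho : IsOpen {s : ℂ | σ < s.re} := isOpen_lt continuous_const Complex.continuous_re
  have hfa := (analyticOnNhd_iff_differentiableOn ho).mpr hf
  have hga := (analyticOnNhd_iff_differentiableOn ho).mpr hg
  have h2 : (2 : ℂ) ∈ {s : ℂ | σ < s.re} := by simp; linarith
  refine hfa.eqOn_of_preconnected_of_eventuallyEq hga (convex_halfSpace_re_gt σ).isPreconnected h2 ?_
  have hn : {s : ℂ | 1 < s.re} ∈ 𝓝 (2 : ℂ) :=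
    (isOpen_lt continuous_const Complex.continuous_re).mem_nhds (by simp)
  filter_upwards [hn] with s hs using h s hs

/-- **Uniqueness on a punctured half-plane**: two functions holomorphic on `{Re s > σ} ∖ {p}` (`σ ≤ 1`,
`p < 1` real) that agree on `{Re s > 1}` agree on `{Re s > σ} ∖ {p}`. [folklore] -/
theorem eqOn_puncturedHalfPlane_of_eqOn {f g : ℂ → ℂ} {σ p : ℝ} (hσ : σ ≤ 1) (hp : p < 1)
    (hf : DifferentiableOn ℂ f {s : ℂ | σ < s.re ∧ s ≠ (p : ℂ)})
    (hg : DifferentiableOn ℂ g {s : ℂ | σ < s.re ∧ s ≠ (p : ℂ)})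
    (h : ∀ s : ℂ, 1 < s.re → f s = g s) : EqOn f g {s : ℂ | σ < s.re ∧ s ≠ (p : ℂ)} := by
  have ho : IsOpen {s : ℂ | σ < s.re ∧ s ≠ (p : ℂ)} :=
    (isOpen_lt continuous_const Complex.continuous_re).inter isOpen_ne
  have hfa := (analyticOnNhd_iff_differentiableOn ho).mpr hf
  have hga := (analyticOnNhd_iff_differentiableOn ho).mpr hg
  have h2 : (2 : ℂ) ∈ {s : ℂ | σ < s.re ∧ s ≠ (p : ℂ)} := by
    refine ⟨by simp; linarith, fun h ↦ ?_⟩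
    have := congrArg Complex.re h; simp at this; linarith
  refine hfa.eqOn_of_preconnected_of_eventuallyEq hga (isPreconnected_halfPlane_diff_ofReal σ p) h2 ?_
  have hn : {s : ℂ | 1 < s.re} ∈ 𝓝 (2 : ℂ) :=
    (isOpen_lt continuous_const Complex.continuous_re).mem_nhds (by simp)
  filter_upwards [hn] with s hs using h s hs

/-! ### (I): the Abel constant is a value of the continuation -/

section abel

variable {S : Set ℕ}

/-- `∫₁^∞ (N'(x) − ax) x^{−β−1} dx`, complex (Mellin) versus real form. [folklore] -/
theorem mellin_errN_keptSystem_ofReal (hT : (keptIdx S).Infinite) (a β : ℝ) :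
    mellin (Hilberdink.errN (keptSystem S hT) a) (-(β : ℂ)) =
      ((∫ t in Ioi (1 : ℝ), (partialSum (freeInd S) t - a * t) * t ^ (-β - 1) : ℝ) : ℂ) := by
  rw [Hilberdink.mellin_errN_eq_setIntegral]
  have h : ∀ t ∈ Ioi (1 : ℝ),
      ((((keptSystem S hT).intCount t : ℝ) - a * t : ℝ) : ℂ) * (t : ℂ) ^ (-(β : ℂ) - 1) =
        (((partialSum (freeInd S) t - a * t) * t ^ (-β - 1) : ℝ) : ℂ) := by
    intro t ht
    have ht0 : 0 ≤ t := le_trans zero_le_one (le_of_lt ht)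
    rw [intCount_keptSystem_eq_partialSum hT ht0, Complex.ofReal_mul, Complex.ofReal_cpow ht0]
    push_cast
    ring_nf
  rw [setIntegral_congr_fun measurableSet_Ioi h]
  exact integral_ofReal

/-- **(I) The Abel constant is the value at `β` of the continuation.** Let `|N'(t) − at| ≤ C t^γ` on `[1,∞)`
(`0 ≤ γ < 1`), and let `Z` be holomorphic on `{Re s > γ}` with `Z(s) = (s − 1) ζ_𝒩(s)` for `Re s > 1`. Then
`a = Z(1)`, and for every real `β ∈ (γ, 1)` the constant `I(β)` of Lemma 5.1 (`abelConst (freeInd S) a β`)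
satisfies `(β − 1) I(β) = Z(β)` ("that is the value at `β` of the meromorphic extension of `∑_{n ∈ 𝒩} n^{−s}`").
[cite: BrouckeDebruyneRevesz2023, Lemma 5.1 and §5 p. 17] -/
theorem abelConst_freeInd_eq (hT : (keptIdx S).Infinite) {a C γ : ℝ} (hγ1 : γ < 1)
    (hA : ∀ t : ℝ, 1 ≤ t → |partialSum (freeInd S) t - a * t| ≤ C * t ^ γ)
    {Z : ℂ → ℂ} (hZ : DifferentiableOn ℂ Z {s : ℂ | γ < s.re})
    (hZeq : ∀ s : ℂ, 1 < s.re → Z s = (s - 1) * (keptSystem S hT).zeta s) :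
    (a : ℂ) = Z 1 ∧
      ∀ β : ℝ, γ < β → β < 1 → (((β - 1) * abelConst (freeInd S) a β : ℝ) : ℂ) = Z β := by
  set P := keptSystem S hT with hP
  have hN : ∀ x : ℝ, 1 ≤ x → |(P.intCount x : ℝ) - a * x| ≤ C * x ^ γ := fun x hx ↦ by
    rw [hP, intCount_keptSystem_eq_partialSum hT (by linarith)]; exact hA x hx
  have hB : ∀ x : ℝ, 1 ≤ x → (P.intCount x : ℝ) ≤ 1 * x := fun x hx ↦ intCount_keptSystem_le hT hx
  -- `Z̃ = Z` on `Re s > γ`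
  have heq : EqOn (Hilberdink.Ztilde P a) Z {s : ℂ | γ < s.re} :=
    eqOn_halfPlane_of_eqOn hγ1.le (Hilberdink.differentiableOn_Ztilde hN) hZ fun s hs ↦ by
      rw [Hilberdink.Ztilde_eq_of_one_lt hB a hs, hZeq s hs]
  constructor
  · have h1 := heq (show (1 : ℂ) ∈ {s : ℂ | γ < s.re} by simp; linarith)
    rw [Hilberdink.Ztilde_one] at h1
    exact h1
  · intro β hγβ hβ1
    have hβ := heq (show ((β : ℝ) : ℂ) ∈ {s : ℂ | γ < s.re} by simpa using hγβ)
    rw [← hβ, Hilberdink.Ztilde, mellin_errN_keptSystem_ofReal hT a β, abelConst]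
    set J : ℝ := ∫ t in Ioi (1 : ℝ), (partialSum (freeInd S) t - a * t) * t ^ (-β - 1) with hJ
    have h1β : (1 : ℂ) - (β : ℂ) ≠ 0 := by
      intro h; have := congrArg Complex.re h; simp at this; linarith
    push_cast
    field_simp
    ring

/-- **(I) in the form used downstream**: under the same hypotheses, for real `β ∈ (γ, 1)` with `Z(β) ≠ 0` and
`γ ≥ 0`, the limit `I = lim_R (∑_{n ≤ R} freeInd S n · n^{−β} − a R^{1−β}/(1−β))` exists and is non-zero.
[cite: BrouckeDebruyneRevesz2023, Lemma 5.1 and §5 p. 17] -/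
theorem exists_abelConst_ne_zero (hT : (keptIdx S).Infinite) {a C γ : ℝ} (hγ0 : 0 ≤ γ) (hγ1 : γ < 1)
    (hA : ∀ t : ℝ, 1 ≤ t → |partialSum (freeInd S) t - a * t| ≤ C * t ^ γ)
    {Z : ℂ → ℂ} (hZ : DifferentiableOn ℂ Z {s : ℂ | γ < s.re})
    (hZeq : ∀ s : ℂ, 1 < s.re → Z s = (s - 1) * (keptSystem S hT).zeta s)
    {β : ℝ} (hγβ : γ < β) (hβ1 : β < 1) (hZβ : Z β ≠ 0) :
    ∃ I : ℝ, I ≠ 0 ∧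
      Tendsto (fun R : ℕ ↦ ∑ n ∈ Finset.Icc 0 R, freeInd S n * (n : ℝ) ^ (-β)
        - a / (1 - β) * (R : ℝ) ^ (1 - β)) atTop (𝓝 I) := by
  refine ⟨abelConst (freeInd S) a β, fun h0 ↦ hZβ ?_,
    tendsto_sum_mul_rpow_neg_sub (freeInd S) (freeInd_zero S) hγ0 hγβ hβ1 hA⟩
  have h := (abelConst_freeInd_eq hT hγ1 hA hZ hZeq).2 β hγβ hβ1
  rw [← h, h0]
  simp

/-- **The density is a value of the continuation**: `a = Z(1)`; in particular `a ≠ 0` when `Z(1) ≠ 0`, and then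
`a > 0` if `a ≥ 0`. [cite: BrouckeDebruyneRevesz2023, §5 p. 16 ("`a = 1/ζ_𝒮(1)`")] -/
theorem density_pos_of_ne_zero (hT : (keptIdx S).Infinite) {a C γ : ℝ} (hγ1 : γ < 1) (ha0 : 0 ≤ a)
    (hA : ∀ t : ℝ, 1 ≤ t → |partialSum (freeInd S) t - a * t| ≤ C * t ^ γ)
    {Z : ℂ → ℂ} (hZ : DifferentiableOn ℂ Z {s : ℂ | γ < s.re})
    (hZeq : ∀ s : ℂ, 1 < s.re → Z s = (s - 1) * (keptSystem S hT).zeta s) (hZ1 : Z 1 ≠ 0) : 0 < a := by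
  have h := (abelConst_freeInd_eq hT hγ1 hA hZ hZeq).1
  rcases ha0.eq_or_lt with h0 | h0
  · exfalso; apply hZ1; rw [← h, ← h0]; simp
  · exact h0

end abel

/-! ### (∂): the boundary case — a pole of `ζ(s/β)` at `s = β` -/

section boundary

variable {S : Set ℕ}

/-- `|ζ(w)| → ∞` as `w → 1`, `w ≠ 1`: from the residue `(w − 1)ζ(w) → 1`. [folklore] -/
theorem tendsto_norm_riemannZeta_atTop :
    Tendsto (fun w : ℂ ↦ ‖riemannZeta w‖) (𝓝[≠] 1) atTop := by
  -- `‖ζ(w)‖ = ‖(w−1)ζ(w)‖ / ‖w − 1‖` with numerator `→ 1` and denominator `→ 0⁺`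
  have h1 : Tendsto (fun w : ℂ ↦ ‖(w - 1) * riemannZeta w‖) (𝓝[≠] 1) (𝓝 1) := by
    simpa using riemannZeta_residue_one.norm
  have h2 : Tendsto (fun w : ℂ ↦ ‖w - 1‖⁻¹) (𝓝[≠] 1) atTop := by
    have ha : Tendsto (fun w : ℂ ↦ ‖w - 1‖) (𝓝[≠] 1) (𝓝[>] 0) := by
      refine tendsto_nhdsWithin_iff.mpr ⟨?_, ?_⟩
      · exact (tendsto_norm_sub_self (1 : ℂ)).mono_left nhdsWithin_le_nhds
      · filter_upwards [self_mem_nhdsWithin] with w hw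
        exact norm_pos_iff.mpr (sub_ne_zero.mpr hw)
    exact tendsto_inv_nhdsGT_zero.comp ha
  have h3 := Tendsto.atTop_mul_pos one_pos h2 h1
  refine h3.congr' ?_
  filter_upwards [self_mem_nhdsWithin] with w hw
  have hw1 : ‖w - 1‖ ≠ 0 := norm_ne_zero_iff.mpr (sub_ne_zero.mpr hw)
  rw [norm_mul]
  field_simp

/-- **(∂) The boundary case.** Let `0 < β < 1`, and let `Z` be holomorphic on `{Re s > σ₀}` (`σ₀ < β`) with
`Z(s) = (s − 1)ζ_𝒩(s)` for `Re s > 1` and `Z(β) ≠ 0`. Then for no `A` and no `ε > 0` is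
`#{(n, m) : n S-free, m ≥ 1, n m^{1/β} ≤ x} = Ax + O(x^{β−ε})` on `[1, ∞)`: such a bound continues
`(s − 1)ζ_{α,β}(s)` (Hilberdink's `Z̃`) holomorphically to `Re s > β − ε`, but `(s−1)ζ_{α,β}(s) = Z(s)ζ(s/β)`
has `|·| → ∞` at `s = β` ("would entail that `ζ_{α,β}(s) = ζ(s)ζ(s/β)/ζ_𝒮(s)` is analytic at `s = β`, which is
false"). [cite: BrouckeDebruyneRevesz2023, §5 p. 17] -/
theorem not_intErrorLE_boundary (hT : (keptIdx S).Infinite) {β : ℝ} (hβ0 : 0 < β) (hβ1 : β < 1)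
    {Z : ℂ → ℂ} {σ₀ : ℝ} (hσ₀ : σ₀ < β) (hZ : DifferentiableOn ℂ Z {s : ℂ | σ₀ < s.re})
    (hZeq : ∀ s : ℂ, 1 < s.re → Z s = (s - 1) * (keptSystem S hT).zeta s) (hZβ : Z β ≠ 0)
    (A ε : ℝ) (hε : 0 < ε) :
    ¬ ∃ C : ℝ, ∀ x : ℝ, 1 ≤ x →
      |(Nat.card {nm : ℕ × ℕ // (nm.1 ≠ 0 ∧ IsFree S nm.1) ∧ nm.2 ≠ 0 ∧
          (nm.1 : ℝ) * (nm.2 : ℝ) ^ β⁻¹ ≤ x} : ℝ) - A * x| ≤ C * x ^ (β - ε) := by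
  rintro ⟨C, hC⟩
  set r : ℝ := β⁻¹ with hrdef
  have hr : 1 < r := (one_lt_inv₀ hβ0).mpr hβ1
  have hr0 : 0 < r := by positivity
  set Q := delSystem S hT r hr0 with hQ
  -- the bound, at the Beurling system `Q = 𝒫_{α,β}`, with a smaller `ε' ≤ ε` so that `β − ε' > σ₀`
  set ε' : ℝ := min ε ((β - σ₀) / 2) with hε'
  have hε'0 : 0 < ε' := lt_min hε (by linarith)
  have hε'ε : ε' ≤ ε := min_le_left _ _
  have hθσ : σ₀ < β - ε' := by have := min_le_right ε ((β - σ₀) / 2); rw [hε']; linarith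
  have hC0 : 0 ≤ C := by
    have h := hC 1 le_rfl
    simp only [Real.one_rpow, mul_one] at h
    exact le_trans (abs_nonneg _) h
  have hN : ∀ x : ℝ, 1 ≤ x → |(Q.intCount x : ℝ) - A * x| ≤ C * x ^ (β - ε') := by
    intro x hx
    rw [hQ, intCount_delSystem hT hr0 x]
    exact (hC x hx).trans (mul_le_mul_of_nonneg_left (Real.rpow_le_rpow_of_exponent_le hx (by linarith)) hC0)
  have hB : ∀ x : ℝ, 1 ≤ x → (Q.intCount x : ℝ) ≤ (|A| + C) * x := by
    intro x hx
    have h := hN x hx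
    have hx0 : 0 < x := by linarith
    have h1 : x ^ (β - ε') ≤ x := by
      calc x ^ (β - ε') ≤ x ^ (1 : ℝ) := Real.rpow_le_rpow_of_exponent_le hx (by linarith)
        _ = x := Real.rpow_one x
    have h2 : (Q.intCount x : ℝ) ≤ A * x + C * x ^ (β - ε') := by
      have := (abs_le.mp h).2; linarith
    have h3 : A * x ≤ |A| * x := mul_le_mul_of_nonneg_right (le_abs_self A) hx0.le
    nlinarith
  -- `Z̃_Q = Z · ζ(r ·)` (`r = 1/β`) on the punctured half-plane `{Re s > β − ε'} ∖ {β}`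
  set g : ℂ → ℂ := fun s ↦ Z s * riemannZeta ((r : ℂ) * s) with hg
  set D : Set ℂ := {s : ℂ | β - ε' < s.re ∧ s ≠ (β : ℂ)} with hD
  have hβc : (β : ℂ) ≠ 0 := by exact_mod_cast hβ0.ne'
  have hrβ : (r : ℂ) * β = 1 := by rw [hrdef]; push_cast; field_simp
  have hgd : DifferentiableOn ℂ g D := by
    intro s hs
    have hs1 : (r : ℂ) * s ≠ 1 := by
      intro h1
      apply hs.2
      calc s = (β : ℂ) * ((r : ℂ) * s) := by rw [← mul_assoc, mul_comm (β : ℂ), hrβ, one_mul]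
        _ = β := by rw [h1, mul_one]
    have hσs : σ₀ < s.re := by have := hs.1; linarith
    have hZs : DifferentiableAt ℂ Z s :=
      (hZ s hσs).differentiableAt ((isOpen_lt continuous_const Complex.continuous_re).mem_nhds hσs)
    have hζ : DifferentiableAt ℂ (fun s : ℂ ↦ riemannZeta ((r : ℂ) * s)) s :=
      (differentiableAt_riemannZeta hs1).comp s ((differentiableAt_const _).mul differentiableAt_id)
    exact (hZs.mul hζ).differentiableWithinAt
  have hfd : DifferentiableOn ℂ (Hilberdink.Ztilde Q A) D :=
    (Hilberdink.differentiableOn_Ztilde hN).mono fun s hs ↦ hs.1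
  have heq : EqOn (Hilberdink.Ztilde Q A) g D := by
    refine eqOn_puncturedHalfPlane_of_eqOn (by linarith) hβ1 hfd hgd fun s hs ↦ ?_
    rw [Hilberdink.Ztilde_eq_of_one_lt hB A hs]
    show (s - 1) * Q.zeta s = Z s * riemannZeta ((r : ℂ) * s)
    rw [hZeq s hs, hQ, zeta_delSystem hT hr hs]
    ring
  -- along `s_n = β + 1/(n+1)` (real, in `D`): `Z̃_Q(s_n)` converges, `‖g(s_n)‖ → ∞`
  set sq : ℕ → ℂ := fun n ↦ ((β + 1 / ((n : ℝ) + 1) : ℝ) : ℂ) with hsq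
  have hsq_re : ∀ n, (sq n).re = β + 1 / ((n : ℝ) + 1) := fun n ↦ by simp only [hsq, Complex.ofReal_re]
  have hsq_pos : ∀ n : ℕ, (0 : ℝ) < 1 / ((n : ℝ) + 1) := fun n ↦ by positivity
  have hsqD : ∀ n, sq n ∈ D := by
    intro n
    refine ⟨by rw [hsq_re]; linarith [hsq_pos n], fun h ↦ ?_⟩
    have h1 := congrArg Complex.re h
    rw [hsq_re, Complex.ofReal_re] at h1
    linarith [hsq_pos n]
  have hsq_tend : Tendsto sq atTop (𝓝 (β : ℂ)) := by
    have h1 : Tendsto (fun n : ℕ ↦ β + 1 / ((n : ℝ) + 1)) atTop (𝓝 (β + 0)) :=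
      tendsto_const_nhds.add tendsto_one_div_add_atTop_nhds_zero_nat
    rw [add_zero] at h1
    exact (Complex.continuous_ofReal.tendsto _).comp h1
  -- `Z̃_Q(s_n) → Z̃_Q(β)`: bounded
  have hβmem : ((β : ℝ) : ℂ) ∈ {s : ℂ | β - ε' < s.re} := by simp; linarith
  have hfcont : ContinuousAt (Hilberdink.Ztilde Q A) (β : ℂ) :=
    ((Hilberdink.differentiableOn_Ztilde hN).differentiableAt
      ((isOpen_lt continuous_const Complex.continuous_re).mem_nhds hβmem)).continuousAt
  have hf_tend : Tendsto (fun n ↦ Hilberdink.Ztilde Q A (sq n)) atTop (𝓝 (Hilberdink.Ztilde Q A β)) :=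
    hfcont.tendsto.comp hsq_tend
  obtain ⟨M, hM⟩ := hf_tend.norm.isBoundedUnder_le
  rw [Filter.eventually_map] at hM
  -- `‖g(s_n)‖ → ∞`
  have hg_tend : Tendsto (fun n ↦ ‖g (sq n)‖) atTop atTop := by
    have hσβ : σ₀ < ((β : ℝ) : ℂ).re := by simp; linarith
    have hZc : ContinuousAt Z (β : ℂ) :=
      ((hZ _ hσβ).differentiableAt ((isOpen_lt continuous_const Complex.continuous_re).mem_nhds hσβ)).continuousAt
    have hZn : Tendsto (fun n ↦ ‖Z (sq n)‖) atTop (𝓝 ‖Z β‖) := (hZc.tendsto.comp hsq_tend).norm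
    have hw : Tendsto (fun n ↦ (r : ℂ) * sq n) atTop (𝓝[≠] 1) := by
      refine tendsto_nhdsWithin_iff.mpr ⟨?_, Eventually.of_forall fun n ↦ ?_⟩
      · have : Tendsto (fun n ↦ (r : ℂ) * sq n) atTop (𝓝 ((r : ℂ) * β)) := hsq_tend.const_mul _
        rwa [hrβ] at this
      · intro h1
        have h2 := congrArg Complex.re h1
        rw [Complex.re_ofReal_mul, hsq_re, Complex.one_re, hrdef, mul_add, inv_mul_cancel₀ hβ0.ne'] at h2
        have : 0 < β⁻¹ * (1 / ((n : ℝ) + 1)) := by positivity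
        linarith
    have hζ : Tendsto (fun n ↦ ‖riemannZeta ((r : ℂ) * sq n)‖) atTop atTop :=
      tendsto_norm_riemannZeta_atTop.comp hw
    have hpos : 0 < ‖Z β‖ := norm_pos_iff.mpr hZβ
    have := Tendsto.pos_mul_atTop hpos hZn hζ
    refine this.congr fun n ↦ ?_
    rw [hg]; simp only [norm_mul]
  -- contradiction
  have hev : ∀ᶠ n in atTop, M + 1 ≤ ‖g (sq n)‖ := (tendsto_atTop.mp hg_tend) (M + 1)
  obtain ⟨n, hn1, hn2⟩ := (hev.and hM).exists
  have : Hilberdink.Ztilde Q A (sq n) = g (sq n) := heq (hsqD n)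
  rw [this] at hn2
  linarith

end boundary

end Literature.NumberTheory.BeurlingPrimes
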